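import Literature.NumberTheory.Transcendental.QuadraticRelationsLogarithmsSec5Count
import Literature.NumberTheory.Transcendental.QuadraticRelationsLogarithmsThm11
import Literature.NumberTheory.Transcendental.LinGroup
import Mathlib.LinearAlgebra.FreeModule.PID
import Mathlib.Algebra.EuclideanDomain.Int
import Mathlib.Analysis.SpecialFunctions.Complex.Log
import HarnessLib

/-!
# Roy–Waldschmidt 1997, §5: `exp_G⁻¹(L)` and the number of classes of `Σ` modulo `L`

D. Roy, M. Waldschmidt, Ann. Sci. ÉNS (4) 30 (1997) 753–796, proof of Théorème 5.1, pp. 781–783.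
With `{η₁, …, η_{ℓ₁}}` a basis of `Y` whose first `ℓ_a` elements form a basis of `Y_a` (p. 780),
`γ_j = exp_G(η_j)`, `Σ = {γ₁^{s₁} ⋯ γ_{ℓ₁}^{s_{ℓ₁}} ; 0 ≤ s_m ≤ S_m}` (p. 781), and `L` a connected
algebraic subgroup of `G = 𝔾ₐ^{d₀} × 𝔾ₘ^{d₁}`, p. 783 uses
"`Card((Σ + L(K))/L(K)) ≥ S₁^{λ_a'} S_{ℓ₁}^{λ' - λ_a'}`",
`λ' = rang_ℤ((Γ + L(K))/L(K))`, `λ_a' = rang_ℤ((Γ_a + L(K))/L(K))` (Théorème 5.1, p. 779).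

This file PROVES the two ingredients, for `L = L₀ × L₁` a `LinGroup.ConnAlgSubgroup d₀ d₁`
(`T_L = L.tangent = T_{L₀} × T_{L₁}`, `Ω = 0 × 2πiℤ^{d₁} = ker exp_G`):

* `ConnAlgSubgroup.exp_mem_toSubgroup_iff` — **`exp_G(y) ∈ L(ℂ) ⟺ y ∈ T_L + Ω`** (the torus `L₁`
  is cut out by a *saturated* group of characters `M`, so `ℤ^{d₁}/M` is free and an integer
  vector `z` with `⟨χ, y⟩ = 2πi⟨χ, z⟩` for all `χ ∈ M` exists as soon as all `⟨χ, y⟩ ∈ 2πiℤ`);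
  hence `rang((Γ + L)/L) = rang Y - rang(Y ∩ (T_L + Ω))` for `Γ = exp_G(Y)`, the dictionary of
  `…Sec5SubspaceForm.lean`;
* `ConnAlgSubgroup.prod_le_ncard_classes` — **the count**: for a `ℤ`-independent family `η` indexed
  by `ι`, a set of indices `P` and box sizes `S`, there is a set of indices `J` with
  `|J| + rang(Y ∩ (T_L+Ω)) ≥ |ι|`, `|J ∩ P| + rang(Y_P ∩ (T_L+Ω)) ≥ |P|` (`Y = ∑ ℤηᵢ`,
  `Y_P = ∑_{i ∈ P} ℤηᵢ`) such that the points `exp_G(∑ᵢ sᵢηᵢ)`, `0 ≤ sᵢ ≤ Sᵢ`, have at least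
  `∏_{i ∈ J} (Sᵢ + 1)` classes modulo `L(ℂ)` (`…Sec5Count.lean` for the choice of `J`).

No definitions, no named facts.

## References

* [RoyWaldschmidt1997ENS] D. Roy, M. Waldschmidt, Ann. Sci. ÉNS (4) 30 (1997) 753–796, proof of
  Théorème 5.1, pp. 780–783; Théorème 5.1 p. 779.
-/

noncomputable section

open Module Submodule Complex

namespace Literature.NumberTheory.Transcendental

namespace LinGroup

namespace ConnAlgSubgroup

variable {d₀ d₁ : ℕ}

/-! ### Saturated character groups: integer solutions -/

/-- **Integer solutions from saturation.**  If `M ≤ ℤ^{d₁}` is saturated (the character group of a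
subtorus) and `y ∈ ℂ^{d₁}` has `⟨χ, y⟩ ∈ 2πiℤ` for all `χ ∈ M`, then there is `z ∈ ℤ^{d₁}` with
`⟨χ, y - 2πi z⟩ = 0` for all `χ ∈ M` (`ℤ^{d₁}/M` is torsion-free, hence free, so `ℤ^{d₁} → ℤ^{d₁}/M`
splits and the additive map `χ ↦ ⟨χ, y⟩/2πi` on `M` extends to `ℤ^{d₁}`). [folklore] -/
theorem exists_int_shift_mem_torusTangent (L : ConnAlgSubgroup d₀ d₁) (y : Fin d₁ → ℂ)
    (hy : ∀ χ ∈ L.chars, ∃ m : ℤ, ∑ j, (χ j : ℂ) * y j = m * (2 * Real.pi * I)) :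
    ∃ z : Fin d₁ → ℤ, (fun j => y j - (z j : ℂ) * (2 * Real.pi * I)) ∈ L.torusTangent := by
  classical
  set Msub : Submodule ℤ (Fin d₁ → ℤ) := AddSubgroup.toIntSubmodule L.chars with hMsub
  have hmemM : ∀ χ, χ ∈ Msub ↔ χ ∈ L.chars := fun χ => Iff.rfl
  -- a basis of `ℤ^{d₁}` adapted to `M` (Smith normal form); by saturation its vectors indexed by
  -- `range f` lie in `M` and `M` is spanned by them
  obtain ⟨n, snf⟩ := Submodule.smithNormalForm (Pi.basisFun ℤ (Fin d₁)) Msub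
  have hmem_f : ∀ i : Fin n, snf.bM (snf.f i) ∈ L.chars := by
    intro i
    have h1 : (snf.bN i : Fin d₁ → ℤ) = snf.a i • snf.bM (snf.f i) := snf.snf i
    have ha : snf.a i ≠ 0 := by
      intro ha
      have : (snf.bN i : Fin d₁ → ℤ) = 0 := by rw [h1, ha, zero_smul]
      exact snf.bN.ne_zero i (Subtype.ext this)
    refine L.saturated (snf.a i) _ ha ?_
    rw [← hmemM, ← h1]
    exact (snf.bN i).2
  have hspanM : ∀ χ ∈ L.chars, χ ∈ Submodule.span ℤ {v | ∃ k, snf.bM k = v ∧ snf.bM k ∈ L.chars} := by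
    intro χ hχ
    have hrepr := snf.bM.sum_repr χ
    haveI : Fintype (Fin d₁) := inferInstance
    rw [← hrepr]
    refine Submodule.sum_mem _ fun k _ => ?_
    by_cases hk : k ∈ Set.range snf.f
    · obtain ⟨i, rfl⟩ := hk
      exact Submodule.smul_mem _ _ (Submodule.subset_span ⟨snf.f i, rfl, hmem_f i⟩)
    · have : snf.bM.repr χ k = 0 := snf.repr_eq_zero_of_notMem_range ⟨χ, (hmemM χ).mpr hχ⟩ hk
      rw [this, zero_smul]
      exact Submodule.zero_mem _
  -- the integers `n(χ)` for the basis vectors in `M`, and the functional `F`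
  have h2pi : (2 * Real.pi * I : ℂ) ≠ 0 := by
    simp [Real.pi_ne_zero, I_ne_zero]
  let g : Fin d₁ → ℤ := fun k => if h : snf.bM k ∈ L.chars then Classical.choose (hy _ h) else 0
  have hg : ∀ k, snf.bM k ∈ L.chars → ∑ j, (snf.bM k j : ℂ) * y j = (g k : ℤ) * (2 * Real.pi * I) := by
    intro k hk
    have := Classical.choose_spec (hy _ hk)
    simp only [g, dif_pos hk]
    exact this
  let F : (Fin d₁ → ℤ) →ₗ[ℤ] ℤ := snf.bM.constr ℤ g
  have hF_basis : ∀ k, F (snf.bM k) = g k := fun k => by simp [F]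
  -- `F χ · 2πi = ⟨χ, y⟩` on `M`
  have hFM' : ∀ χ ∈ Submodule.span ℤ {v | ∃ k, snf.bM k = v ∧ snf.bM k ∈ L.chars},
      ∑ j, (χ j : ℂ) * y j = (F χ : ℤ) * (2 * Real.pi * I) := by
    intro χ hmem
    induction hmem using Submodule.span_induction with
    | mem v hv =>
      obtain ⟨k, rfl, hk⟩ := hv
      rw [hF_basis, hg k hk]
    | zero => simp
    | add v w _ _ hv hw =>
      rw [map_add, Int.cast_add, add_mul, ← hv, ← hw, ← Finset.sum_add_distrib]
      refine Finset.sum_congr rfl fun j _ => ?_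
      simp only [Pi.add_apply, Int.cast_add]; ring
    | smul c v _ hv =>
      rw [map_smul, smul_eq_mul, Int.cast_mul, mul_assoc, ← hv, Finset.mul_sum]
      refine Finset.sum_congr rfl fun j _ => ?_
      simp only [Pi.smul_apply, smul_eq_mul, Int.cast_mul]; ring
  have hFM : ∀ χ ∈ L.chars, ∑ j, (χ j : ℂ) * y j = (F χ : ℤ) * (2 * Real.pi * I) :=
    fun χ hχ => hFM' χ (hspanM χ hχ)
  -- `z_j = F(e_j)`
  refine ⟨fun j => F (Pi.single j 1), ?_⟩
  rw [mem_torusTangent_iff]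
  intro χ hχ
  have hχsum : χ = ∑ j, χ j • (Pi.single j (1 : ℤ) : Fin d₁ → ℤ) := by
    funext i
    simp only [Finset.sum_apply, Pi.smul_apply, smul_eq_mul]
    rw [Finset.sum_eq_single i]
    · simp
    · intro j _ hji; simp [Pi.single_eq_of_ne' hji]
    · intro h; exact absurd (Finset.mem_univ i) h
  have hFχ : (F χ : ℤ) = ∑ j, χ j * F (Pi.single j 1) := by
    conv_lhs => rw [hχsum]
    rw [map_sum]
    refine Finset.sum_congr rfl fun j _ => ?_
    rw [map_smul, smul_eq_mul]
  have hyχ := hFM χ hχ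
  have e1 : ∑ j, (χ j : ℂ) * (y j - (F (Pi.single j 1) : ℂ) * (2 * Real.pi * I)) =
      ∑ j, (χ j : ℂ) * y j - (∑ j, (χ j : ℂ) * (F (Pi.single j 1) : ℂ)) * (2 * Real.pi * I) := by
    rw [Finset.sum_mul, ← Finset.sum_sub_distrib]
    refine Finset.sum_congr rfl fun j _ => by ring
  rw [e1, hyχ]
  have hcast : (∑ j, (χ j : ℂ) * (F (Pi.single j 1) : ℂ)) = ((F χ : ℤ) : ℂ) := by
    rw [hFχ]; push_cast; rfl
  rw [hcast]
  ring

/-! ### `exp_G⁻¹(L) = T_L + Ω` -/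

/-- `∏ⱼ (e^{yⱼ})^{χⱼ} = exp(∑ⱼ χⱼ yⱼ)` in `ℂˣ`. [folklore] -/
theorem prod_exp_zpow_eq (y : Fin d₁ → ℂ) (χ : Fin d₁ → ℤ) :
    ((∏ j, ((LinGroup.exp ((0 : Fin d₀ → ℂ), y)).2 j) ^ (χ j) : ℂˣ) : ℂ) = cexp (∑ j, (χ j : ℂ) * y j) := by
  rw [Complex.exp_sum]
  push_cast
  refine Finset.prod_congr rfl fun j _ => ?_
  rw [LinGroup.coe_exp_snd, ← Complex.exp_int_mul]

/-- **`exp_G(y) ∈ L(ℂ) ⟺ y ∈ T_L + Ω`**, `Ω = 0 × 2πiℤ^{d₁}`, for a connected algebraic subgroup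
`L = L₀ × L₁` of `𝔾ₐ^{d₀} × 𝔾ₘ^{d₁}`. [folklore] -/
theorem exp_mem_toSubgroup_iff (L : ConnAlgSubgroup d₀ d₁) (y : (Fin d₀ → ℂ) × (Fin d₁ → ℂ)) :
    LinGroup.exp y ∈ L.toSubgroup ↔
      y ∈ (L.tangent.restrictScalars ℤ ⊔ RoyWaldschmidt1997.omegaLattice d₀ d₁) := by
  classical
  rw [mem_toSubgroup_iff, Submodule.mem_sup]
  have hexp2 : ∀ χ : Fin d₁ → ℤ, (∏ j, ((LinGroup.exp y).2 j) ^ (χ j) = 1) ↔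
      ∃ m : ℤ, ∑ j, (χ j : ℂ) * y.2 j = m * (2 * Real.pi * I) := by
    intro χ
    rw [← Units.val_eq_one]
    have e : ((∏ j, ((LinGroup.exp y).2 j) ^ (χ j) : ℂˣ) : ℂ) = cexp (∑ j, (χ j : ℂ) * y.2 j) := by
      have := prod_exp_zpow_eq (d₀ := d₀) y.2 χ
      have hy : (LinGroup.exp y).2 = (LinGroup.exp ((0 : Fin d₀ → ℂ), y.2)).2 := by
        funext j; rfl
      rw [hy]; exact this
    rw [e, Complex.exp_eq_one_iff]
  constructor
  · rintro ⟨h1, h2⟩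
    have h2' : ∀ χ ∈ L.chars, ∃ m : ℤ, ∑ j, (χ j : ℂ) * y.2 j = m * (2 * Real.pi * I) :=
      fun χ hχ => (hexp2 χ).mp (h2 χ hχ)
    obtain ⟨z, hz⟩ := L.exists_int_shift_mem_torusTangent y.2 h2'
    refine ⟨(y.1, fun j => y.2 j - (z j : ℂ) * (2 * Real.pi * I)), ?_,
      (0, fun j => (z j : ℂ) * (2 * Real.pi * I)), ?_, ?_⟩
    · show (y.1, fun j => y.2 j - (z j : ℂ) * (2 * Real.pi * I)) ∈ L.tangent
      rw [mem_tangent_iff]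
      exact ⟨by simpa using h1, hz⟩
    · exact ⟨rfl, fun j => ⟨z j, rfl⟩⟩
    · ext j <;> simp
  · rintro ⟨t, ht, w, hw, rfl⟩
    have ht' : t ∈ L.tangent := ht
    rw [mem_tangent_iff] at ht'
    obtain ⟨hw1, hw2⟩ := (RoyWaldschmidt1997.mem_omegaLattice).mp hw
    refine ⟨?_, fun χ hχ => ?_⟩
    · simp only [LinGroup.toAdd_exp_fst, Prod.fst_add, hw1, add_zero]
      exact ht'.1
    · rw [hexp2]
      choose m hm using hw2
      refine ⟨∑ j, χ j * m j, ?_⟩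
      have htt : ∑ j, (χ j : ℂ) * t.2 j = 0 := (mem_torusTangent_iff _ _).mp ht'.2 χ hχ
      calc ∑ j, (χ j : ℂ) * (t + w).2 j = ∑ j, (χ j : ℂ) * t.2 j + ∑ j, (χ j : ℂ) * w.2 j := by
            rw [← Finset.sum_add_distrib]
            refine Finset.sum_congr rfl fun j _ => ?_
            simp only [Prod.snd_add, Pi.add_apply]; ring
        _ = ∑ j, (χ j : ℂ) * w.2 j := by rw [htt, zero_add]
        _ = ((∑ j, χ j * m j : ℤ) : ℂ) * (2 * Real.pi * I) := by
            push_cast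
            rw [Finset.sum_mul]
            refine Finset.sum_congr rfl fun j _ => ?_
            rw [hm j]; ring

/-! ### The number of classes of the box `Σ` modulo `L` -/

/-- `exp_G(-w) = exp_G(w)⁻¹`. [folklore] -/
theorem exp_neg' (w : (Fin d₀ → ℂ) × (Fin d₁ → ℂ)) : LinGroup.exp (-w) = (LinGroup.exp w)⁻¹ := by
  have h : LinGroup.exp (-w) * LinGroup.exp w = 1 := by rw [← LinGroup.exp_add, neg_add_cancel, LinGroup.exp_zero]
  exact eq_inv_of_mul_eq_one_left h

/-- **The count of classes** (Roy–Waldschmidt 1997, p. 783: "`Card((Σ + L(K))/L(K)) ≥ S₁^{λ_a'}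
S_{ℓ₁}^{λ'-λ_a'}`").  For a `ℤ`-independent family `η` in `T_G(ℂ)` indexed by `ι`, a set of indices
`P` and box sizes `Sᵢ`, there is a set of indices `J` with `|J| + rang(Y ∩ (T_L + Ω)) ≥ |ι|` and
`|J ∩ P| + rang(Y_P ∩ (T_L + Ω)) ≥ |P|` (`Y = ∑ᵢ ℤηᵢ`, `Y_P = ∑_{i∈P} ℤηᵢ`, `Ω = 0 × 2πiℤ^{d₁}`) such
that the points `exp_G(∑ᵢ sᵢηᵢ)`, `0 ≤ sᵢ ≤ Sᵢ`, fall into at least `∏_{i∈J} (Sᵢ + 1)` classes modulo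
`L(ℂ)` (the points with `s` supported in `J` are pairwise incongruent, by
`exp_mem_toSubgroup_iff` and `RoyWaldschmidt1997.exists_indep_indices`).
[cite: RoyWaldschmidt1997ENS, proof of Théorème 5.1, p. 783] -/
theorem prod_le_ncard_classes (L : ConnAlgSubgroup d₀ d₁) {ι : Type*} [Fintype ι] [DecidableEq ι]
    (η : ι → (Fin d₀ → ℂ) × (Fin d₁ → ℂ)) (hη : LinearIndependent ℤ η) (P : Finset ι) (S : ι → ℕ) :
    ∃ J : Finset ι,
      Fintype.card ι ≤ J.card + Module.finrank ℤ ↥(Submodule.span ℤ (Set.range η) ⊓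
        (L.tangent.restrictScalars ℤ ⊔ RoyWaldschmidt1997.omegaLattice d₀ d₁)) ∧
      P.card ≤ (J.filter (· ∈ P)).card + Module.finrank ℤ ↥(Submodule.span ℤ (η '' ↑P) ⊓
        (L.tangent.restrictScalars ℤ ⊔ RoyWaldschmidt1997.omegaLattice d₀ d₁)) ∧
      ∏ i ∈ J, (S i + 1) ≤ Set.ncard ((QuotientGroup.mk : LinGroup d₀ d₁ → LinGroup d₀ d₁ ⧸ L.toSubgroup) ''
        Set.range (fun s : (∀ i, Fin (S i + 1)) => LinGroup.exp (∑ i, ((s i : ℕ) : ℤ) • η i))) := by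
  classical
  set SL : Submodule ℤ ((Fin d₀ → ℂ) × (Fin d₁ → ℂ)) :=
    L.tangent.restrictScalars ℤ ⊔ RoyWaldschmidt1997.omegaLattice d₀ d₁ with hSL
  -- coordinates
  set φ : (ι → ℤ) →ₗ[ℤ] ((Fin d₀ → ℂ) × (Fin d₁ → ℂ)) := Fintype.linearCombination ℤ η with hφ
  have hφ_apply : ∀ z, φ z = ∑ i, z i • η i := fun z => Fintype.linearCombination_apply (R := ℤ) η z
  have hφinj : Function.Injective φ := by
    rw [← LinearMap.ker_eq_bot, Submodule.eq_bot_iff]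
    intro z hz
    rw [LinearMap.mem_ker, hφ_apply] at hz
    exact funext (Fintype.linearIndependent_iff.mp hη z hz)
  have hφrange : LinearMap.range φ = Submodule.span ℤ (Set.range η) := Fintype.range_linearCombination ℤ η
  set N : Submodule ℤ (ι → ℤ) := SL.comap φ with hN
  obtain ⟨J, hJi, hJii, hJiii⟩ := RoyWaldschmidt1997.exists_indep_indices N P
  -- ranks
  have hN_rank : Module.finrank ℤ N = Module.finrank ℤ ↥(Submodule.span ℤ (Set.range η) ⊓ SL) := by
    rw [← RoyWaldschmidt1997.finrank_map_of_injective φ hφinj N, hN, Submodule.map_comap_eq, hφrange]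
  have hφsupp : (RoyWaldschmidt1997.suppZ (↑P : Set ι)).map φ = Submodule.span ℤ (η '' ↑P) := by
    apply le_antisymm
    · rintro _ ⟨z, hz, rfl⟩
      rw [hφ_apply]
      refine Submodule.sum_mem _ fun i _ => ?_
      by_cases hi : i ∈ P
      · exact Submodule.smul_mem _ _ (Submodule.subset_span ⟨i, hi, rfl⟩)
      · rw [(RoyWaldschmidt1997.mem_suppZ.mp hz) i (by simpa using hi), zero_smul]
        exact Submodule.zero_mem _
    · refine Submodule.span_le.mpr ?_
      rintro _ ⟨i, hi, rfl⟩
      refine ⟨Pi.single i 1, ?_, ?_⟩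
      · show Pi.single i (1 : ℤ) ∈ RoyWaldschmidt1997.suppZ (↑P : Set ι)
        rw [RoyWaldschmidt1997.mem_suppZ]
        intro k hk
        have : k ≠ i := fun h => hk (h ▸ hi)
        simp [Pi.single_eq_of_ne this]
      · rw [hφ_apply, Finset.sum_eq_single i]
        · simp
        · intro k _ hki; simp [Pi.single_eq_of_ne hki]
        · intro h; exact absurd (Finset.mem_univ i) h
  have hNP_rank : Module.finrank ℤ ↥(N ⊓ RoyWaldschmidt1997.suppZ (↑P : Set ι)) =
      Module.finrank ℤ ↥(Submodule.span ℤ (η '' ↑P) ⊓ SL) := by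
    rw [← RoyWaldschmidt1997.finrank_map_of_injective φ hφinj, Submodule.map_inf φ hφinj, hφsupp, hN,
      Submodule.map_comap_eq, hφrange]
    -- `span (range η) ⊓ SL ⊓ span (η '' P) = span (η '' P) ⊓ SL`
    have hle : Submodule.span ℤ (η '' ↑P) ≤ Submodule.span ℤ (Set.range η) :=
      Submodule.span_mono (by rintro _ ⟨i, _, rfl⟩; exact ⟨i, rfl⟩)
    have heq : Submodule.span ℤ (Set.range η) ⊓ SL ⊓ Submodule.span ℤ (η '' ↑P) = Submodule.span ℤ (η '' ↑P) ⊓ SL := by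
      apply le_antisymm
      · exact le_inf (inf_le_right) (inf_le_left.trans inf_le_right)
      · exact le_inf (le_inf (inf_le_left.trans hle) inf_le_right) inf_le_left
    rw [heq]
  refine ⟨J, by rw [← hN_rank]; exact hJii, by rw [← hNP_rank]; exact hJiii, ?_⟩
  -- the count: the sub-box supported in `J` injects
  let ext : (∀ i : J, Fin (S i + 1)) → (∀ i, Fin (S i + 1)) := fun t i =>
    if h : i ∈ J then t ⟨i, h⟩ else 0
  let cls : (∀ i, Fin (S i + 1)) → LinGroup d₀ d₁ ⧸ L.toSubgroup := fun s =>
    QuotientGroup.mk (LinGroup.exp (∑ i, ((s i : ℕ) : ℤ) • η i))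
  have hext_off : ∀ t i, i ∉ J → ext t i = 0 := fun t i hi => by simp [ext, hi]
  have hext_on : ∀ t (i : J), ext t i = t i := fun t i => by simp [ext, i.2]
  have hinj : Function.Injective (cls ∘ ext) := by
    intro t t' h
    simp only [Function.comp_apply, cls] at h
    rw [QuotientGroup.eq] at h
    -- `exp(∑ (s' - s) η) ∈ L`
    set a : ι → ℤ := fun i => ((ext t i : ℕ) : ℤ) with ha
    set a' : ι → ℤ := fun i => ((ext t' i : ℕ) : ℤ) with ha'
    have hsum : ∀ b : ι → ℤ, (∑ i, b i • η i) = φ b := fun b => (hφ_apply b).symm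
    rw [hsum a, hsum a', ← exp_neg', ← LinGroup.exp_add, ← map_neg, ← map_add, exp_mem_toSubgroup_iff] at h
    have hmemN : (-a + a') ∈ N := h
    have hzero : -a + a' = 0 := by
      refine hJi _ hmemN fun i hi => ?_
      simp [ha, ha', hext_off t i hi, hext_off t' i hi]
    funext i
    have := congrFun hzero i
    simp only [Pi.add_apply, Pi.neg_apply, Pi.zero_apply, ha, ha', hext_on] at this
    have h2 : ((t i : ℕ) : ℤ) = ((t' i : ℕ) : ℤ) := by linarith
    exact Fin.ext (by exact_mod_cast h2)
  have hsub : Set.range (cls ∘ ext) ⊆ (QuotientGroup.mk : LinGroup d₀ d₁ → LinGroup d₀ d₁ ⧸ L.toSubgroup) ''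
      Set.range (fun s : (∀ i, Fin (S i + 1)) => LinGroup.exp (∑ i, ((s i : ℕ) : ℤ) • η i)) := by
    rintro _ ⟨t, rfl⟩
    exact ⟨_, ⟨ext t, rfl⟩, rfl⟩
  have hfin : ((QuotientGroup.mk : LinGroup d₀ d₁ → LinGroup d₀ d₁ ⧸ L.toSubgroup) ''
      Set.range (fun s : (∀ i, Fin (S i + 1)) => LinGroup.exp (∑ i, ((s i : ℕ) : ℤ) • η i))).Finite :=
    (Set.finite_range _).image _
  calc ∏ i ∈ J, (S i + 1) = Fintype.card (∀ i : J, Fin (S i + 1)) := by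
        rw [Fintype.card_pi]
        simp only [Fintype.card_fin]
        rw [← Finset.prod_coe_sort J]
    _ = Set.ncard (Set.range (cls ∘ ext)) := by
        rw [Set.ncard_range_of_injective hinj, Nat.card_eq_fintype_card]
    _ ≤ _ := Set.ncard_le_ncard hsub hfin

end ConnAlgSubgroup

end LinGroup

end Literature.NumberTheory.Transcendental
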